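import Summits.QuantumFields.BalabanUV.Beta.GAN24.TaylorLamBracket
import Summits.QuantumFields.BalabanUV.Beta.GAN24.TaylorMassLam
import Summits.QuantumFields.BalabanUV.Beta.GAN24.TaylorBlockSum

/-!
# `BalabanUV.Beta.GAN24.TaylorRowLamTopTable` — binder row G-an2-4 / (CONV-C), S-slot road «S3-Taylor», PART III SHAPE ROW **S3-Lt** (ROW-Λt), part 1 of 2
# (holder b2b-balaban-gan24-formalise-leaf-10, gen 12; CLAIM l.4646): THE SYNTHETIC TABLE of the top Λ row — an1's lifted one-step constraint Hessian
# `avgLift M (hessFF Lc μ Y)` read at the lattice points `u = N•Y` — its supports, radii and per-`y` mass, and THE Λ VERTEX IN THE SHAPE OF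
# `TaylorSandwich.sandwich_bound` (generic `d`, any blockings; part 2 `GAN24/TaylorRowLamTop` assembles the row at `d = 3`).

NOT IN PRINT; OUR PROOF ATTEMPT (unit b2b-balaban-gan24-formalise-leaf-10, gen 12).  HONEST FRAMING (cell contract, verbatim): «discharging `BetaPertH` makes
Bałaban's UV stability UNCONDITIONAL — a real constructive-QFT result; it is NOT the continuum limit and NOT the Clay problem.»  HONEST DEPENDENCY (verbatim):
«continuum YM on T⁴ ⇐ BetaPertH ∧ nine spine estimates (0/9 proved); BetaPertH ⇐ (D1) ∧ (D4) ∧ CAP+tail; G-an2-4 gates asym, D1 and NE2/3/4.»  [folklore]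
bookkeeping over TREE modules BY NAME: leaf-10's `TaylorLamBracket.vertex_lagrInc_top` (the Λ vertex insertion at the top level — `ResolventComposition.wM_eq_zero`
underneath), `InterLevelTransport.onLat` (re-indexing onto the lattice points, as leaf-08's ROW-Λ0 contraction), leaf-11's L2 `TaylorMassLam.abs_avgLift_hessFF_le` ∕
`avgLift_hessFF_ne_zero`, leaf-04's `TaylorBlockSum.l1_quo_sub_quo_le`, an2's `AxialDressingRooted.cube`.  THREE plumbing `def`s (`tabT`, `suppU`, `suppW`; assert
nothing), 0 cite, 0 `def … : Prop`, no estimate of (N1)∕(N3).  Discharges NOTHING of (hS, hSall) by itself.  NOT summit progress.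

WHAT IS PROVED ([folklore], 0 sorry): §1 `tabT` + `tabT_zsmul`∕`tabT_off`, `tsum_reindex` (`Function.Injective.tsum_eq` along `Y ↦ N•Y`), **`vertex_sandwich_form`**
(`Σ_{κ″} c₁·Σ'_u (c₂·wH_N κ″ κ′ (u − N•u′))·lagrInc(κ″,u)(w,y,l,l′) = Σ_μ c₁·Σ'_u (c₂·wΦ_N κ′ μ (u′ − quo N u))·tabT μ u w l y l′` — `sandwich_bound`'s vertex bracket with
`H := c₂·wΦ_N κ′ · (u′ − quo N ·)` and table `tabT`); §2 `tabT_support` (lattice point; both field legs within `2(d+1)(Lc+1)·M` of it, `N = M·Lc`), the finite supports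
`suppU` (lattice points, block-index radius `K`) ∕ `suppW` (fine radius `K₂`) with `card_supp*_le`, `l1_sub_le_of_mem_supp*`, `mem_supp*_of_ne_zero`, `abs_tabT_le`
(`≤ 2ℓ²∕M^{2(d+1)}`) and **`mass_tabT_le`** (per-`y` mass `≤ (2K₂+1)^{d+1}(d+1)²(2K+1)^{d+1}·2ℓ²∕M^{2(d+1)}` — with `K₂ ∝ M` this is `∝ M^{−(d+1)}`, the factor that makes the
top Λ row's constant `n`-free in part 2).
-/

noncomputable section

open Finset
open scoped BigOperators
open Literature.MathematicalPhysics.QuantumFieldTheory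
open Literature.MathematicalPhysics.QuantumFieldTheory.LatticeForm (quo)
open Literature.Probability.LatticeModels (Torus.proj)
open Literature.MathematicalPhysics.QuantumFieldTheory.Balaban1983to89
open Literature.MathematicalPhysics.QuantumFieldTheory.Balaban1983to89.Beta
open B12Sec2to5 (l1 l1_nonneg)
open ExpKernelCalculus (MKer l1_sub_symm l1_sub_triangle l1_natSmul)
open AffineAveraging (Site)
open OneStepResolventKernel (Fib KInv proj_zsmul quo_zsmul eq_zsmul_quo_of_proj)
open KernelSpecInstance (wH wΦ)
open InterLevelTransport (avgLift onLat onLat_zsmul onLat_off)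
open BalabanCompositeJets (lagrInc l1_sub_zsmul_quo_le)
open AveragingHessianKernels (hessFF ell)
open Summit.QuantumFields.BalabanUV.Beta.AxialDressingRooted (cube mem_cube card_cube)
open Summit.QuantumFields.BalabanUV.Beta.GAN24.TaylorLamBracket (vertex_lagrInc_top)
open Summit.QuantumFields.BalabanUV.Beta.GAN24.TaylorMassLam (abs_avgLift_hessFF_le avgLift_hessFF_ne_zero)
open Summit.QuantumFields.BalabanUV.Beta.GAN24.TaylorBlockSum (l1_quo_sub_quo_le)

namespace Summit.QuantumFields.BalabanUV.Beta.GAN24.TaylorRowLamTopTable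

variable {d : ℕ}

/-! ## §1 The lifted Hessian table read at the lattice points, and the vertex in `sandwich_bound`'s shape -/

section Table

variable {Lc M N : ℕ}

/-- [folklore] THE SYNTHETIC TABLE: an1's lifted one-step constraint Hessian `avgLift M (hessFF Lc μ Y)` read at the lattice point `u = N•Y` of its coarse
bond (zero off `N•ℤ^{d+1}`), field–field block, in the argument order of `TaylorSandwich.sandwich_bound`'s `T`. Plumbing only; asserts nothing. -/
def tabT (Lc M N : ℕ) (μ : Fin (d + 1)) (u w : Site (d + 1)) (l : Fin (d + 1)) (y : Site (d + 1)) (l' : Fin (d + 1)) : ℝ :=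
  onLat N (fun Y => avgLift M (hessFF (d := d) Lc μ Y)) u w y (Sum.inl l) (Sum.inl l')

/-- [folklore] On the lattice the table reads the lifted Hessian. -/
theorem tabT_zsmul [NeZero N] (μ : Fin (d + 1)) (Y w : Site (d + 1)) (l : Fin (d + 1)) (y : Site (d + 1)) (l' : Fin (d + 1)) :
    tabT Lc M N μ ((N : ℤ) • Y) w l y l' = avgLift M (hessFF (d := d) Lc μ Y) w y (Sum.inl l) (Sum.inl l') := by
  simp only [tabT, onLat_zsmul]

/-- [folklore] Off the lattice the table vanishes. -/
theorem tabT_off {u : Site (d + 1)} (hu : Torus.proj N u ≠ 0) (μ : Fin (d + 1)) (w : Site (d + 1)) (l : Fin (d + 1)) (y : Site (d + 1))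
    (l' : Fin (d + 1)) : tabT Lc M N μ u w l y l' = 0 := by
  simp only [tabT, onLat_off _ hu]
  rfl

/-- [folklore] RE-INDEXING the coarse superposition onto the lattice points: `Σ'_u (c·wΦ_N κ′ μ (u′ − quo N u))·tabT μ u = Σ'_Y (c·wΦ_N κ′ μ (u′ − Y))·avgLift M (hessFF Lc μ Y)`. -/
theorem tsum_reindex [NeZero N] (c : ℝ) (κ' μ : Fin (d + 1)) (u' w y : Site (d + 1)) (l l' : Fin (d + 1)) :
    ∑' u, (c * wΦ (N := N) κ' μ (u' - quo N u)) * tabT Lc M N μ u w l y l' =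
      ∑' Y, (c * wΦ (N := N) κ' μ (u' - Y)) * avgLift M (hessFF (d := d) Lc μ Y) w y (Sum.inl l) (Sum.inl l') := by
  have hinj : Function.Injective (fun Y : Site (d + 1) => (N : ℤ) • Y) := fun Y Y' h => by
    have h2 := congrArg (quo N) h
    simpa only [quo_zsmul] using h2
  rw [← hinj.tsum_eq (f := fun u => (c * wΦ (N := N) κ' μ (u' - quo N u)) * tabT Lc M N μ u w l y l')]
  · exact tsum_congr fun Y => by simp only [quo_zsmul, tabT_zsmul]
  · intro v hv
    by_cases h0 : Torus.proj N v = 0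
    · exact ⟨quo N v, (eq_zsmul_quo_of_proj (N := N) h0).symm⟩
    · refine (Function.mem_support.mp hv ?_).elim
      show (c * wΦ (N := N) κ' μ (u' - quo N v)) * tabT Lc M N μ v w l y l' = 0
      rw [tabT_off h0, mul_zero]

/-- [folklore] **THE Λ VERTEX IN `sandwich_bound`'s SHAPE** (top level, any scalars `c₁, c₂`): by `TaylorLamBracket.vertex_lagrInc_top` and `tsum_reindex`,
`Σ_{κ″} c₁·Σ'_u (c₂·wH_N κ″ κ′ (u − N•u′))·lagrInc(κ″,u)(w,y,l,l′) = Σ_μ c₁·Σ'_u (c₂·wΦ_N κ′ μ (u′ − quo N u))·tabT μ u w l y l′`. -/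
theorem vertex_sandwich_form [NeZero N] [NeZero M] (hLc : 1 ≤ Lc) (c₁ c₂ : ℝ) (κ' : Fin (d + 1)) (u' w y : Site (d + 1)) (l l' : Fin (d + 1)) :
    ∑ κ'', c₁ * ∑' u, (c₂ * wH (N := N) κ'' κ' (u - (N : ℤ) • u')) * lagrInc d Lc M N κ'' u w y (Sum.inl l) (Sum.inl l') =
      ∑ μ, c₁ * ∑' u, (c₂ * wΦ (N := N) κ' μ (u' - quo N u)) * tabT Lc M N μ u w l y l' := by
  have hL : ∀ κ'', ∑' u, (c₂ * wH (N := N) κ'' κ' (u - (N : ℤ) • u')) * lagrInc d Lc M N κ'' u w y (Sum.inl l) (Sum.inl l') =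
      c₂ * ∑' u, wH (N := N) κ'' κ' (u - (N : ℤ) • u') * lagrInc d Lc M N κ'' u w y (Sum.inl l) (Sum.inl l') := by
    intro κ''; rw [← tsum_mul_left]; exact tsum_congr fun u => by ring
  have hR : ∀ μ, ∑' u, (c₂ * wΦ (N := N) κ' μ (u' - quo N u)) * tabT Lc M N μ u w l y l' =
      c₂ * ∑' Y, wΦ (N := N) κ' μ (u' - Y) * avgLift M (hessFF (d := d) Lc μ Y) w y (Sum.inl l) (Sum.inl l') := by
    intro μ; rw [tsum_reindex, ← tsum_mul_left]; exact tsum_congr fun Y => by ring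
  calc ∑ κ'', c₁ * ∑' u, (c₂ * wH (N := N) κ'' κ' (u - (N : ℤ) • u')) * lagrInc d Lc M N κ'' u w y (Sum.inl l) (Sum.inl l')
      = ∑ κ'', (c₁ * c₂) * ∑' u, wH (N := N) κ'' κ' (u - (N : ℤ) • u') * lagrInc d Lc M N κ'' u w y (Sum.inl l) (Sum.inl l') := by
        refine Finset.sum_congr rfl fun κ'' _ => ?_
        rw [hL]; ring
    _ = (c₁ * c₂) * ∑ μ, ∑' Y, wΦ (N := N) κ' μ (u' - Y) * avgLift M (hessFF (d := d) Lc μ Y) w y (Sum.inl l) (Sum.inl l') := by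
        rw [← Finset.mul_sum, vertex_lagrInc_top M hLc]
    _ = ∑ μ, c₁ * ∑' u, (c₂ * wΦ (N := N) κ' μ (u' - quo N u)) * tabT Lc M N μ u w l y l' := by
        rw [Finset.mul_sum]
        refine Finset.sum_congr rfl fun μ _ => ?_
        rw [hR]; ring

end Table

/-! ## §2 Supports and the per-`y` mass of the synthetic table (generic `d`, `N = M·Lc`) -/

section Support

variable {Lc M N : ℕ} [NeZero M] [NeZero N]

/-- [folklore] A coordinate is at most the `ℓ¹` norm. -/
theorem abs_apply_le_l1 (t : Site (d + 1)) (i : Fin (d + 1)) : |((t i : ℤ) : ℝ)| ≤ l1 t :=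
  Finset.single_le_sum (f := fun j => |((t j : ℤ) : ℝ)|) (fun _ _ => abs_nonneg _) (Finset.mem_univ i)

/-- [folklore] The `ℓ¹` norm of a point of the cube of radius `K` is at most `(d+1)·K`. -/
theorem l1_le_of_mem_cube {K : ℕ} {t : Site (d + 1)} (ht : t ∈ cube (d + 1) K) : l1 t ≤ ((d : ℝ) + 1) * K := by
  rw [mem_cube] at ht
  calc l1 t = ∑ j, |((t j : ℤ) : ℝ)| := rfl
    _ ≤ ∑ _j : Fin (d + 1), (K : ℝ) := Finset.sum_le_sum fun j _ => by
        have h := ht j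
        rw [← Int.cast_abs]
        exact_mod_cast h
    _ = ((d : ℝ) + 1) * K := by simp [mul_comm]

/-- [folklore] A point of `ℓ¹` norm at most `K` lies in the cube of radius `K`. -/
theorem mem_cube_of_l1_le {K : ℕ} {t : Site (d + 1)} (ht : l1 t ≤ K) : t ∈ cube (d + 1) K := by
  rw [mem_cube]
  intro i
  have h := (abs_apply_le_l1 t i).trans ht
  rw [← Int.cast_abs] at h
  exact_mod_cast h

/-- [folklore] SUPPORT OF THE TABLE: a nonzero entry sits at a lattice point `u = N•(quo N u)` with both field legs `w, y` within `ℓ¹`-distance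
`2(d+1)(Lc+1)·M` of `u` (leaf-11's `avgLift_hessFF_ne_zero`, `N = M·Lc`). -/
theorem tabT_support (hLc : 1 ≤ Lc) (hN : N = M * Lc) {μ : Fin (d + 1)} {u w : Site (d + 1)} {l : Fin (d + 1)} {y : Site (d + 1)}
    {l' : Fin (d + 1)} (h : tabT Lc M N μ u w l y l' ≠ 0) :
    u = (N : ℤ) • quo N u ∧ l1 (w - u) ≤ 2 * ((d : ℝ) + 1) * (Lc + 1) * M ∧ l1 (y - u) ≤ 2 * ((d : ℝ) + 1) * (Lc + 1) * M := by
  by_cases h0 : Torus.proj N u = 0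
  · have hu : u = (N : ℤ) • quo N u := eq_zsmul_quo_of_proj (N := N) h0
    have h1 : tabT Lc M N μ u w l y l' = avgLift M (hessFF (d := d) Lc μ (quo N u)) w y (Sum.inl l) (Sum.inl l') := by
      conv_lhs => rw [hu]
      rw [tabT_zsmul]
    rw [h1] at h
    have h2 := avgLift_hessFF_ne_zero M hLc h
    have h3 : ((M * Lc : ℕ) : ℤ) • quo N u = u := by rw [← hN]; exact hu.symm
    rw [h3] at h2
    exact ⟨hu, h2.1, h2.2⟩
  · exact absurd (tabT_off h0 μ w l y l') h

/-- [folklore] The finite set of lattice points around the block of `y` that can carry the table (radius `K` in the block index). -/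
def suppU (d N K : ℕ) (y : Site (d + 1)) : Finset (Site (d + 1)) :=
  (cube (d + 1) K).image fun t => (N : ℤ) • (quo N y + t)

/-- [folklore] The finite set of `w`-legs around `y` that can carry the table (radius `K₂` in fine units). -/
def suppW (d K₂ : ℕ) (y : Site (d + 1)) : Finset (Site (d + 1)) :=
  (cube (d + 1) K₂).image fun t => y + t

omit [NeZero M] [NeZero N] in
/-- [folklore] Cardinality of `suppU`. -/
theorem card_suppU_le (K : ℕ) (y : Site (d + 1)) : ((suppU d N K y).card : ℝ) ≤ ((2 * K + 1 : ℕ) : ℝ) ^ (d + 1) := by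
  have h := (Finset.card_image_le (s := cube (d + 1) K) (f := fun t => (N : ℤ) • (quo N y + t)))
  rw [card_cube] at h
  exact_mod_cast h

omit [NeZero M] [NeZero N] in
/-- [folklore] Cardinality of `suppW`. -/
theorem card_suppW_le (K₂ : ℕ) (y : Site (d + 1)) : ((suppW d K₂ y).card : ℝ) ≤ ((2 * K₂ + 1 : ℕ) : ℝ) ^ (d + 1) := by
  have h := (Finset.card_image_le (s := cube (d + 1) K₂) (f := fun t => y + t))
  rw [card_cube] at h
  exact_mod_cast h

omit [NeZero M] in
/-- [folklore] `ℓ¹` radius of `suppU` around `y`: `N·((d+1)K + (d+1))`. -/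
theorem l1_sub_le_of_mem_suppU {K : ℕ} {y u : Site (d + 1)} (hu : u ∈ suppU d N K y) :
    l1 (u - y) ≤ (N : ℝ) * (((d : ℝ) + 1) * K + ((d : ℝ) + 1)) := by
  rw [suppU, Finset.mem_image] at hu
  obtain ⟨t, ht, rfl⟩ := hu
  have h1 : (N : ℤ) • (quo N y + t) - y = ((N : ℤ) • quo N y - y) + (N : ℤ) • t := by rw [smul_add]; abel
  rw [h1]
  have h2 := l1_sub_triangle (((N : ℤ) • quo N y - y) + (N : ℤ) • t) ((N : ℤ) • t) 0
  rw [sub_zero, sub_zero, add_sub_cancel_right] at h2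
  have h3 : l1 ((N : ℤ) • quo N y - y) ≤ ((d : ℝ) + 1) * N := by
    rw [l1_sub_symm]; exact_mod_cast l1_sub_zsmul_quo_le N y
  have h4 : l1 ((N : ℤ) • t) ≤ (N : ℝ) * (((d : ℝ) + 1) * K) := by
    rw [l1_natSmul]; exact mul_le_mul_of_nonneg_left (l1_le_of_mem_cube ht) (Nat.cast_nonneg N)
  nlinarith [h2, h3, h4]

omit [NeZero M] [NeZero N] in
/-- [folklore] `ℓ¹` radius of `suppW` around `y`: `(d+1)·K₂`. -/
theorem l1_sub_le_of_mem_suppW {K₂ : ℕ} {y w : Site (d + 1)} (hw : w ∈ suppW d K₂ y) : l1 (w - y) ≤ ((d : ℝ) + 1) * K₂ := by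
  rw [suppW, Finset.mem_image] at hw
  obtain ⟨t, ht, rfl⟩ := hw
  rw [add_sub_cancel_left]
  exact l1_le_of_mem_cube ht

/-- [folklore] A nonzero table entry has its lattice point in `suppU` (radius `K ≥ 2(d+1)(Lc+1) + (d+1)` in the block index). -/
theorem mem_suppU_of_ne_zero (hLc : 1 ≤ Lc) (hN : N = M * Lc) {K : ℕ} (hK : 2 * ((d : ℝ) + 1) * (Lc + 1) + ((d : ℝ) + 1) ≤ K)
    {μ : Fin (d + 1)} {u w : Site (d + 1)} {l : Fin (d + 1)} {y : Site (d + 1)} {l' : Fin (d + 1)} (h : tabT Lc M N μ u w l y l' ≠ 0) :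
    u ∈ suppU d N K y := by
  obtain ⟨hu, -, hy⟩ := tabT_support hLc hN h
  rw [suppU, Finset.mem_image]
  refine ⟨quo N u - quo N y, mem_cube_of_l1_le ?_, by rw [add_sub_cancel]; exact hu.symm⟩
  have hNpos : (0 : ℝ) < N := by exact_mod_cast Nat.pos_of_ne_zero (NeZero.ne N)
  have hM : (M : ℝ) ≤ N := by
    rw [hN]; push_cast
    have h1 : (1 : ℝ) ≤ Lc := by exact_mod_cast hLc
    have hM0 : (0 : ℝ) ≤ M := Nat.cast_nonneg M
    nlinarith [h1, hM0]
  have h1 := l1_quo_sub_quo_le (N := N) u y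
  have h2 : l1 (u - y) / N ≤ 2 * ((d : ℝ) + 1) * (Lc + 1) := by
    rw [div_le_iff₀ hNpos, l1_sub_symm]
    calc l1 (y - u) ≤ 2 * ((d : ℝ) + 1) * (Lc + 1) * M := hy
      _ ≤ 2 * ((d : ℝ) + 1) * (Lc + 1) * N := mul_le_mul_of_nonneg_left hM (by positivity)
  have h3 : ((d + 1 : ℕ) : ℝ) = (d : ℝ) + 1 := by push_cast; ring
  rw [h3] at h1
  linarith

omit [NeZero N] in
/-- [folklore] A nonzero table entry has its `w`-leg in `suppW` (radius `K₂ ≥ 4(d+1)(Lc+1)·M` in fine units). -/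
theorem mem_suppW_of_ne_zero [NeZero N] (hLc : 1 ≤ Lc) (hN : N = M * Lc) {K₂ : ℕ} (hK : 4 * ((d : ℝ) + 1) * (Lc + 1) * M ≤ K₂)
    {μ : Fin (d + 1)} {u w : Site (d + 1)} {l : Fin (d + 1)} {y : Site (d + 1)} {l' : Fin (d + 1)} (h : tabT Lc M N μ u w l y l' ≠ 0) :
    w ∈ suppW d K₂ y := by
  obtain ⟨-, hw, hy⟩ := tabT_support hLc hN h
  rw [suppW, Finset.mem_image]
  refine ⟨w - y, mem_cube_of_l1_le ?_, by abel⟩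
  have h1 := l1_sub_triangle w u y
  rw [l1_sub_symm u y] at h1
  linarith

/-- [folklore] POINTWISE SIZE of the table: `≤ 2ℓ²∕M^{2(d+1)}` (leaf-11's `abs_avgLift_hessFF_le`; zero off the lattice). -/
theorem abs_tabT_le (hLc : 1 ≤ Lc) (μ : Fin (d + 1)) (u w : Site (d + 1)) (l : Fin (d + 1)) (y : Site (d + 1)) (l' : Fin (d + 1)) :
    |tabT Lc M N μ u w l y l'| ≤ 2 * (ell (d + 1) Lc : ℝ) ^ 2 / (M : ℝ) ^ (2 * (d + 1)) := by
  by_cases h0 : Torus.proj N u = 0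
  · have hu : u = (N : ℤ) • quo N u := eq_zsmul_quo_of_proj (N := N) h0
    rw [hu, tabT_zsmul]
    exact abs_avgLift_hessFF_le M hLc μ _ w y _ _
  · rw [tabT_off h0, abs_zero]; positivity

/-- [folklore] **THE PER-`y` MASS OF THE TABLE** over the supports: `≤ (2K₂+1)^{d+1}·(d+1)·(d+1)·(2K+1)^{d+1}·2ℓ²∕M^{2(d+1)}`. -/
theorem mass_tabT_le (hLc : 1 ≤ Lc) (K K₂ : ℕ) (y : Site (d + 1)) (l' : Fin (d + 1)) :
    ∑ w ∈ suppW d K₂ y, ∑ l : Fin (d + 1), ∑ μ : Fin (d + 1), ∑ u ∈ suppU d N K y, |tabT Lc M N μ u w l y l'| ≤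
      ((2 * K₂ + 1 : ℕ) : ℝ) ^ (d + 1) * (((d : ℝ) + 1) * (((d : ℝ) + 1) * (((2 * K + 1 : ℕ) : ℝ) ^ (d + 1) *
        (2 * (ell (d + 1) Lc : ℝ) ^ 2 / (M : ℝ) ^ (2 * (d + 1)))))) := by
  set B := 2 * (ell (d + 1) Lc : ℝ) ^ 2 / (M : ℝ) ^ (2 * (d + 1)) with hB
  have hB0 : 0 ≤ B := by positivity
  have hu : ∀ w l μ, ∑ u ∈ suppU d N K y, |tabT Lc M N μ u w l y l'| ≤ ((2 * K + 1 : ℕ) : ℝ) ^ (d + 1) * B := by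
    intro w l μ
    calc ∑ u ∈ suppU d N K y, |tabT Lc M N μ u w l y l'| ≤ ∑ _u ∈ suppU d N K y, B :=
          Finset.sum_le_sum fun u _ => abs_tabT_le hLc μ u w l y l'
      _ = (suppU d N K y).card * B := by rw [Finset.sum_const, nsmul_eq_mul]
      _ ≤ ((2 * K + 1 : ℕ) : ℝ) ^ (d + 1) * B := mul_le_mul_of_nonneg_right (card_suppU_le K y) hB0
  have hμ : ∀ w l, ∑ μ : Fin (d + 1), ∑ u ∈ suppU d N K y, |tabT Lc M N μ u w l y l'| ≤
      ((d : ℝ) + 1) * (((2 * K + 1 : ℕ) : ℝ) ^ (d + 1) * B) := by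
    intro w l
    calc ∑ μ : Fin (d + 1), ∑ u ∈ suppU d N K y, |tabT Lc M N μ u w l y l'| ≤ ∑ _μ : Fin (d + 1), ((2 * K + 1 : ℕ) : ℝ) ^ (d + 1) * B :=
          Finset.sum_le_sum fun μ _ => hu w l μ
      _ = ((d : ℝ) + 1) * (((2 * K + 1 : ℕ) : ℝ) ^ (d + 1) * B) := by simp
  have hl : ∀ w, ∑ l : Fin (d + 1), ∑ μ : Fin (d + 1), ∑ u ∈ suppU d N K y, |tabT Lc M N μ u w l y l'| ≤
      ((d : ℝ) + 1) * (((d : ℝ) + 1) * (((2 * K + 1 : ℕ) : ℝ) ^ (d + 1) * B)) := by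
    intro w
    calc ∑ l : Fin (d + 1), ∑ μ : Fin (d + 1), ∑ u ∈ suppU d N K y, |tabT Lc M N μ u w l y l'|
        ≤ ∑ _l : Fin (d + 1), ((d : ℝ) + 1) * (((2 * K + 1 : ℕ) : ℝ) ^ (d + 1) * B) := Finset.sum_le_sum fun l _ => hμ w l
      _ = ((d : ℝ) + 1) * (((d : ℝ) + 1) * (((2 * K + 1 : ℕ) : ℝ) ^ (d + 1) * B)) := by simp
  have hpos : 0 ≤ ((d : ℝ) + 1) * (((d : ℝ) + 1) * (((2 * K + 1 : ℕ) : ℝ) ^ (d + 1) * B)) := by positivity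
  calc ∑ w ∈ suppW d K₂ y, ∑ l : Fin (d + 1), ∑ μ : Fin (d + 1), ∑ u ∈ suppU d N K y, |tabT Lc M N μ u w l y l'|
      ≤ ∑ _w ∈ suppW d K₂ y, ((d : ℝ) + 1) * (((d : ℝ) + 1) * (((2 * K + 1 : ℕ) : ℝ) ^ (d + 1) * B)) :=
        Finset.sum_le_sum fun w _ => hl w
    _ = (suppW d K₂ y).card * (((d : ℝ) + 1) * (((d : ℝ) + 1) * (((2 * K + 1 : ℕ) : ℝ) ^ (d + 1) * B))) := by
        rw [Finset.sum_const, nsmul_eq_mul]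
    _ ≤ ((2 * K₂ + 1 : ℕ) : ℝ) ^ (d + 1) * (((d : ℝ) + 1) * (((d : ℝ) + 1) * (((2 * K + 1 : ℕ) : ℝ) ^ (d + 1) * B))) :=
        mul_le_mul_of_nonneg_right (card_suppW_le K₂ y) hpos

end Support

end Summit.QuantumFields.BalabanUV.Beta.GAN24.TaylorRowLamTopTable

end
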